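import Literature.MathematicalPhysics.QuantumFieldTheory.Balaban1983to89.B8SockH59NotAtUnivDegenerate
import Literature.MathematicalPhysics.QuantumFieldTheory.Balaban1983to89.B8Prop3GaugeFixedKLevel
import Literature.MathematicalPhysics.QuantumFieldTheory.Balaban1983to89.B8LeafModelZd3H

/-!
# `Balaban1983to89.B8Prop3BodyNotAtEmptyBonds` — KERNEL CERTIFICATE: [Balaban1985RegularSpaces] PROPOSITION 3 AS TYPED on n05-a's family `B8LeafModelZd3.zdGF3`
# (`B8.Prop3Body c d L C₂ inp B₀β`, for EVERY threshold `c > 0`) is FALSE at members of `ZdIdx d L` with `Ω_j = ℤᵈ` and EMPTY top constraint-BOND classes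
# (`Λb k ≡ ∅`) — so `B8.Prop3Printed d L C₂ inp B₀β` on the law-free univ sub-family `{i // i.Ω 0 = univ}` (and on all of `ZdIdx d L`) is FALSE as typed

statement-level skeleton of published theorems with citation tags; proofs where landed; nothing here is a claim about the
Yang–Mills mass gap

`[Balaban1985RegularSpaces]` ("B8", CMP **99** (1985) 75–102) Prop. 3 p. 87 with (1.40)–(1.42) p. 83 and (1.61) p. 86, (1.36) p. 82, (1.12) p. 78 / p. 86 (the constraint
bonds 𝔅_k of the Λ-tower), p. 77 («Ω_j = T_η»).  PDF held: `paper:balaban1985-cmp99-regular-spaces-gauge-fixing`.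

CITATION HEADER (lean-in-tree rule).  Cell `pub-ymgap` (YM Track A, HUMAN RULING D-0062), DAG node N16 = NE3 (consumer of node N05 = [B8]), seat
`pub-ymgap-dag-n16-c` (g6).  Companion of this seat's `B8SockH59NotAtUnivDegenerate` (the (1.59) socket is false at univ members with empty lower-truncation
data — a №8-violating member of the four-law census `B8IdxB8LawsB`) and of n05-c ∕ ref-A's bond-law certificates (`B8IdxB8LawsB.not_idxB8LawsB_of_bonds_empty`:
the b9 socket binder fails at members with empty bond classes — №12).  HERE the located defect is read one storey higher, on node N05's TYPED THEOREM itself: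
at a member whose top constraint-bond classes `Λb k j` are EMPTY (admissible in `ZdIdx`: the laws `hbox`∕`hclass` are upper bounds on `Λb`; `htower`∕`hpart`
read `Λs k`) the hypothesis (1.42) of Proposition 3 («`Q_j(U₀, ηA) = B` on `Λ_j`, `|B| < 2dLα₁`» — the member's field `C137`, quantified over `Λb k j`) is VACUOUS,
and the CONSTANT abelian field `A = a·δ_τ`, `a = t·1`, `t = α₂(Lᵏη)⁻¹` (its configuration `W = e^{iηA}` = the pure gauge `gaugeAct u⁻¹ 1` of the linear phase
`u(x) = g₀^{x_τ}`, `g₀ = e^{iηa}`) meets every other hypothesis at background `U₀ = 1`: (1.40) `InAk` by gauge invariance of `𝔄_k` (`B8Ineq132.inAk_gaugeAct_iff` +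
`one_inAk`), (1.41) `C162 1 α₂` with the canonical logarithm (`B8Prop3GaugeFixedKLevel.logField_spec`, `α₂ ≤ 1/16`), the Landau condition (1.42)₁ with multiplier `0`
(flat covariant divergence of a constant field, as in the companion).  Proposition 3's first conclusion (1.36)₁ at the top level then reads `α₂ ≤ 5dLB₀(α₀ + α₁)`,
which FAILS inside the (1.61)-window for `α₀ = α₁ = s := 2(1+|C₂|)α₂²` and `α₂ < 1∕(20dLB₀(1+|C₂|))` — for EVERY threshold `c > 0`.  ★ `prop3Clause_false_of_emptyBonds`
(the member clause), `exists_member_univ_emptyBonds` (`Ω ≡ ℤᵈ`, PROPER constraint sites `Λs m j = {j = m}`, `Λb ≡ ∅`; it satisfies the three laws of `Node00.IdxB8Laws`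
at `η = L⁻ᵏ` but NOT the bond law №12), ★★ `not_prop3Printed_zdGF3_univ` (`¬ B8.Prop3Printed d L C₂ inp B₀β (fun i : {i // i.Ω 0 = univ} ↦ (zdGF3 𝔸 L β len i.1).toGFData2)`),
`not_prop3Printed_zdGF3` (whole index), `not_prop3Printed_zdGF3H_univ` (n05-c's repaired carrier: same `GFData2` part).

CONSEQUENCE (recorded, count-neutral).  Every theorem whose hypothesis is `B8.Prop3Printed …` ∕ `B8.Prop3Body c …` on the law-free univ sub-family of `zdGF3` (e.g.
`Summit.….N16.OfLeaf.n16_of_leaf`, `N16OfLeafTP.n16_of_leafTP`, the univ-keyed record slots of the N16 kit) is VACUOUS as stated; n05-a's `prop3Printed_zd3` (modulo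
`∀ i, SockB9P3 … i`) has a false conclusion, so its socket binder is unsatisfiable (consistent with the bond-law certificates).  NOT affected: Proposition 3 on node
N05's sub-index of record `IdxB8SubB` (law №12 excludes the witness member) and on the all-torus PROPER (pinned) sub-index of `Summit.….N16OfSocketsAllTorus(Pinned)`
(`Λb m j = {j = m}` — all block bonds).  PRINT IS CONSISTENT: 𝔅_k is generated by the Λ-tower ((1.12) p. 78), never empty.

HONEST SCOPE.  A negative typing certificate with an explicit witness; nothing of [Balaban1985RegularSpaces] is proved or refuted; count-neutral; N05 ∕ N16 NOT
discharged; SECOND-GAP: none; one finite `T⁴` programme at fixed `ε`, Bałaban as printed; nothing continuum ∕ ℝ⁴ ∕ OS ∕ mass-gap ∕ Clay.  No `sorry`, no `def`, no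
`instance`, no `notation`.  Unit `pub-ymgap-dag-n16-c` (g6), 2026-08-27.
-/

noncomputable section

namespace Literature.MathematicalPhysics.QuantumFieldTheory.Balaban1983to89.B8Prop3BodyNotAtEmptyBonds

open NormedSpace
open Complex (I)
open B7Prop1Explicit (e e_apply expUnit val_expUnit gaugeAct)
open B7Prop2Explicit (unitaryUnits unitaryUnits_le_U1)
open B8Lemma1NonAbelian (mulCfg)
open B8Ineq132 (covDeriv covDerivFwd InAk inAk_gaugeAct_iff)
open B8Eq184Proof (cfgExp)
open B8Eq138LandauZd (covDivB covLap QT IsLandau138 IsLandau138W logCfg)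
open B8Eq140Level (SideTouches sideTouches_of_bondTouches)
open B8Eq191FlatStencils (covDeriv_flat_apply covLap_flat_apply QT_flat_apply)
open B8Ineq130 (tlo thi)
open B8Eq131Cubes (flm under_flm)
open B8Eq106Local (under_iff_tower)
open B8LeafModelZd (ZdIdx)
open B8LeafModelZd3 (zdGF3)
open B8LeafModelZd3H (zdGF3H)
open B8Prop6OfThm4 (one_inAk)
open B8Thm4Concrete (mulCfg_eq_mul)
open B8Prop3GaugeFixedKLevel (logField_spec)

export B7Prop1Explicit (Site)

variable {d : ℕ}

/-! ## §1 ★ Proposition 3's clause at a member with `Ω ≡ ℤᵈ` and EMPTY top bond classes is false, for every threshold -/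

section Clause

variable {𝔸 : Type} [CStarAlgebra 𝔸] [Nontrivial 𝔸]

/-- ★ **PROPOSITION 3 AS TYPED IS FALSE AT A MEMBER OF `zdGF3` WITH `Ω_j = ℤᵈ` AND EMPTY TOP CONSTRAINT-BOND CLASSES** (`d ≥ 2`, `L ≥ 1`, any Hölder data `β, len`,
EVERY threshold `c > 0`, every `C₂`, `inp`, `B₀β`): the clause of `B8.Prop3Body c d L C₂ inp B₀β` at the member `i` (`∀ j, i.Ω j = univ`, `∀ j ≤ i.k, i.Λb i.k j = ∅`) fails.
WITNESS at `U₀ = 1`: the constant abelian field `A = a·δ_τ`, `a = t·1`, `t = α₂(Lᵏη)⁻¹`, `W = e^{iηA} = gaugeAct u⁻¹ 1` (`u(x) = g₀^{x_τ}`, `g₀ = e^{iηa}`), with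
`α₀ = α₁ = 2(1+|C₂|)α₂²`, `α₂ = min {c, 1/16, 1/(20d), 1/(2(1+|C₂|)), 1/(40dLB₀(1+|C₂|))}`: (1.40) by gauge invariance of `𝔄_k`, (1.41) by `logField_spec`, (1.42)₁ with
multiplier `0`, (1.42)₂ vacuous (`Λb ≡ ∅`); the conclusion (1.36)₁ at level `k` would give `α₂ ≤ 5dLB₀(α₀ + α₁) = 20dLB₀(1+|C₂|)α₂² ≤ α₂∕2`, absurd.
[cite: Balaban1985RegularSpaces, Prop. 3 p.87, (1.40)–(1.42) p.83, (1.61) p.86, (1.36) p.82, (1.12) p.78, p.77] -/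
theorem prop3Clause_false_of_emptyBonds (hd2 : 2 ≤ d) {L : ℕ} (hL : 1 ≤ L) (β : ℝ) (len : Site d → ℝ) (i : ZdIdx d L)
    (hΩ : ∀ j, i.Ω j = Set.univ) (hΛb : ∀ j, j ≤ i.k → i.Λb i.k j = ∅) {c : ℝ} (hc : 0 < c) (C₂ : ℝ) (inp : B8.B9Inputs) (B₀β : ℝ) :
    ¬ (∀ α₀ α₁ α₂ : ℝ, 0 < α₀ → α₀ ≤ c → 0 < α₁ → α₁ ≤ c → 0 < α₂ → α₂ ≤ c →
        2 * α₂ ^ 2 + 20 * d * α₀ * α₂ + 2 * C₂ * α₂ ^ 2 ≤ α₀ + α₁ →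
        ∀ U₀ : (zdGF3 𝔸 L β len i).Cfg, ∀ U₁ : (zdGF3 𝔸 L β len i).Pert,
          (zdGF3 𝔸 L β len i).InA α₀ U₀ → (zdGF3 𝔸 L β len i).Reg335 α₀ U₀ → (zdGF3 𝔸 L β len i).InAPair α₀ U₀ U₁ →
          (zdGF3 𝔸 L β len i).C162 1 α₂ U₀ U₁ → (zdGF3 𝔸 L β len i).Landau U₀ U₁ → (zdGF3 𝔸 L β len i).C137 α₁ U₀ U₁ →
            (zdGF3 𝔸 L β len i).C136 (5 * d * L * inp.B₀) (5 * d * L * B₀β) (α₀ + α₁) U₀ U₁ ∧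
            (zdGF3 𝔸 L β len i).C139 (5 * d * L * inp.B₀) (α₀ + α₁) U₀ U₁) := by
  intro H
  -- shorthand
  have hL1 : (1 : ℝ) ≤ L := by exact_mod_cast hL
  have hL0 : (0 : ℝ) < L := by exact_mod_cast (show 0 < L by omega)
  have hd0 : (0 : ℝ) < d := by exact_mod_cast (lt_of_lt_of_le (by norm_num) hd2)
  have hη : 0 < i.η := i.hη
  have hB₀ : 0 < inp.B₀ := inp.B₀_pos
  haveI : Nontrivial (Fin d) := Fin.nontrivial_iff_two_le.mpr hd2
  obtain ⟨τ₀⟩ : Nonempty (Fin d) := ⟨⟨0, by omega⟩⟩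
  have hside : ∀ (j : ℕ) (y : Site d) (τ : Fin d), SideTouches (i.Ω j) y τ := by
    intro j y τ
    rw [hΩ j]
    obtain ⟨κ, hκ⟩ := exists_ne τ
    exact sideTouches_of_bondTouches hκ (Or.inl (Set.mem_univ y))
  -- THE WINDOW POINT: `K = 1 + |C₂|`, `α₂` small, `α₀ = α₁ = s := 2Kα₂²`
  obtain ⟨K, hK⟩ : ∃ K : ℝ, K = 1 + |C₂| := ⟨_, rfl⟩
  have hK1 : 1 ≤ K := by rw [hK]; have := abs_nonneg C₂; linarith
  have hK0 : 0 < K := by linarith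
  have hKC : 1 + C₂ ≤ K := by rw [hK]; have := le_abs_self C₂; linarith
  obtain ⟨α₂, hα₂⟩ : ∃ α₂ : ℝ, α₂ = min c (min (1 / 16) (min (1 / (20 * d)) (min (1 / (2 * K)) (1 / (40 * d * L * inp.B₀ * K))))) :=
    ⟨_, rfl⟩
  have hα₂c : α₂ ≤ c := by rw [hα₂]; exact min_le_left _ _
  have hα₂16 : α₂ ≤ 1 / 16 := by rw [hα₂]; exact (min_le_right _ _).trans (min_le_left _ _)
  have hα₂d : α₂ ≤ 1 / (20 * d) := by
    rw [hα₂]; exact (min_le_right _ _).trans ((min_le_right _ _).trans (min_le_left _ _))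
  have hα₂K : α₂ ≤ 1 / (2 * K) := by
    rw [hα₂]; exact (min_le_right _ _).trans ((min_le_right _ _).trans ((min_le_right _ _).trans (min_le_left _ _)))
  have hα₂B : α₂ ≤ 1 / (40 * d * L * inp.B₀ * K) := by
    rw [hα₂]; exact (min_le_right _ _).trans ((min_le_right _ _).trans ((min_le_right _ _).trans (min_le_right _ _)))
  have hα₂0 : 0 < α₂ := by
    rw [hα₂]
    refine lt_min hc (lt_min (by norm_num) (lt_min (by positivity) (lt_min (by positivity) (by positivity))))
  obtain ⟨s, hs⟩ : ∃ s : ℝ, s = 2 * K * α₂ ^ 2 := ⟨_, rfl⟩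
  have hs0 : 0 < s := by rw [hs]; positivity
  have h2Kα : 2 * K * α₂ ≤ 1 := by
    have h := mul_le_mul_of_nonneg_left hα₂K (by positivity : (0 : ℝ) ≤ 2 * K)
    rwa [mul_one_div_cancel (by positivity : (2 : ℝ) * K ≠ 0)] at h
  have hsc : s ≤ c := by
    have h1 : s ≤ α₂ := by
      rw [hs]
      calc 2 * K * α₂ ^ 2 = (2 * K * α₂) * α₂ := by ring
        _ ≤ 1 * α₂ := mul_le_mul_of_nonneg_right h2Kα hα₂0.le
        _ = α₂ := one_mul _
    exact h1.trans hα₂c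
  have h20dα : 20 * d * α₂ ≤ 1 := by
    have h := mul_le_mul_of_nonneg_left hα₂d (by positivity : (0 : ℝ) ≤ 20 * d)
    rwa [mul_one_div_cancel (by positivity : (20 : ℝ) * d ≠ 0)] at h
  have h161 : 2 * α₂ ^ 2 + 20 * d * s * α₂ + 2 * C₂ * α₂ ^ 2 ≤ s + s := by
    have h1 : 2 * α₂ ^ 2 + 2 * C₂ * α₂ ^ 2 ≤ s := by
      rw [hs]
      have hα2 : 0 ≤ α₂ ^ 2 := sq_nonneg _
      nlinarith
    have h2 : 20 * d * s * α₂ ≤ s := by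
      calc 20 * d * s * α₂ = (20 * d * α₂) * s := by ring
        _ ≤ 1 * s := mul_le_mul_of_nonneg_right h20dα hs0.le
        _ = s := one_mul _
    linarith
  -- the violated inequality: `α₂ ≤ 5dLB₀(s+s)` is impossible
  have hviol : ¬ α₂ ≤ 5 * (d : ℝ) * L * inp.B₀ * (s + s) := by
    intro h
    have h40 : 40 * (d : ℝ) * L * inp.B₀ * K * α₂ ≤ 1 := by
      have h' := mul_le_mul_of_nonneg_left hα₂B (by positivity : (0 : ℝ) ≤ 40 * d * L * inp.B₀ * K)
      rwa [mul_one_div_cancel (by positivity : (40 : ℝ) * d * L * inp.B₀ * K ≠ 0)] at h'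
    have h' : α₂ ≤ (40 * (d : ℝ) * L * inp.B₀ * K * α₂) * α₂ / 2 := by
      rw [hs] at h; nlinarith
    have h'' : (40 * (d : ℝ) * L * inp.B₀ * K * α₂) * α₂ / 2 ≤ α₂ / 2 := by
      have := mul_le_mul_of_nonneg_right h40 hα₂0.le
      linarith
    linarith
  -- THE WITNESS at `U₀ = 1`: `t = α₂(Lᵏη)⁻¹`, `a = t·1`, `g₀ = e^{iηa}`, `u(x) = g₀^{x_τ₀}`, `W = gaugeAct u⁻¹ 1` (constant), `A′ = a·δ_τ₀`
  obtain ⟨t, ht⟩ : ∃ t : ℝ, t = α₂ * ((L : ℝ) ^ i.k * i.η)⁻¹ := ⟨_, rfl⟩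
  have ht0 : 0 < t := by rw [ht]; positivity
  obtain ⟨a, ha⟩ : ∃ a : 𝔸, a = ((t : ℝ) : ℂ) • (1 : 𝔸) := ⟨_, rfl⟩
  have ha_sa : IsSelfAdjoint a := by rw [ha]; exact B8Eq155JBound.isSelfAdjoint_real_smul t (IsSelfAdjoint.one 𝔸)
  have ha_norm : ‖a‖ = t := by rw [ha, norm_smul, Complex.norm_real, Real.norm_of_nonneg ht0.le, norm_one, mul_one]
  obtain ⟨g₀, hg₀⟩ : ∃ g₀ : 𝔸ˣ, g₀ = expUnit ((I : ℂ) • (i.η • a)) := ⟨_, rfl⟩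
  have hg₀u : g₀ ∈ unitaryUnits 𝔸 := by
    rw [B7Prop2Explicit.mem_unitaryUnits, hg₀, val_expUnit]
    exact B8Ineq170.exp_I_smul_mem_unitary (B8Prop5Reality.isSelfAdjoint_real_smul i.η ha_sa)
  obtain ⟨u, hu⟩ : ∃ u : Site d → 𝔸ˣ, u = fun x => g₀ ^ (x τ₀) := ⟨_, rfl⟩
  have h1 : ∀ x, u x ∈ unitaryUnits 𝔸 := fun x => by rw [hu]; exact (unitaryUnits 𝔸).zpow_mem hg₀u _
  obtain ⟨W, hW⟩ : ∃ W : Site d → Fin d → 𝔸ˣ, W = gaugeAct u⁻¹ (1 : Site d → Fin d → 𝔸ˣ) := ⟨_, rfl⟩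
  have hWval : ∀ (x : Site d) (κ : Fin d), W x κ = g₀ ^ (e κ τ₀) := by
    intro x κ
    rw [hW, gaugeAct, hu]
    simp only [Pi.inv_apply, Pi.one_apply, mul_one, inv_inv, Pi.add_apply]
    rw [← zpow_neg, ← zpow_add, neg_add_cancel_left]
  have hWτ : ∀ x : Site d, W x τ₀ = g₀ := fun x => by rw [hWval, e_apply, if_pos rfl, zpow_one]
  have hW1 : ∀ (x : Site d) (κ : Fin d), κ ≠ τ₀ → W x κ = 1 := fun x κ hκ => by
    rw [hWval, e_apply, if_neg (Ne.symm hκ), zpow_zero]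
  have hWu : ∀ x κ, W x κ ∈ unitaryUnits 𝔸 := fun x κ => by rw [hWval]; exact (unitaryUnits 𝔸).zpow_mem hg₀u _
  obtain ⟨A', hA'⟩ : ∃ A' : Site d → Fin d → 𝔸, A' = fun _ κ => if κ = τ₀ then a else 0 := ⟨_, rfl⟩
  have hA'τ : ∀ y : Site d, A' y τ₀ = a := fun y => by rw [hA']; exact if_pos rfl
  have hA'1 : ∀ (y : Site d) (κ : Fin d), κ ≠ τ₀ → A' y κ = 0 := fun y κ hκ => by rw [hA']; exact if_neg hκ
  have hA'bd : ∀ (y : Site d) (κ : Fin d), ‖A' y κ‖ ≤ t := by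
    intro y κ
    by_cases hκ : κ = τ₀
    · rw [hκ, hA'τ, ha_norm]
    · rw [hA'1 y κ hκ, norm_zero]; exact ht0.le
  have hWexp : ∀ (y : Site d) (τ : Fin d), W y τ = cfgExp i.η A' y τ := by
    intro y τ
    by_cases hτ : τ = τ₀
    · rw [hτ, hWτ, hg₀]
      exact Units.ext (by rw [val_expUnit, cfgExp, val_expUnit, hA'τ])
    · rw [hW1 y τ hτ]
      exact Units.ext (by rw [cfgExp, val_expUnit, hA'1 y τ hτ, smul_zero, smul_zero, NormedSpace.exp_zero, Units.val_one])
  -- the canonical logarithm of `W` IS `A′` (principal logarithm of a unitary near `1`): `‖A′‖ ≤ (α₂ L^{−k})·η⁻¹`, `α₂ L^{−k} ≤ 1/16`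
  have hLk1 : (1 : ℝ) ≤ (L : ℝ) ^ i.k := one_le_pow₀ hL1
  have htη : t = (α₂ * ((L : ℝ) ^ i.k)⁻¹) * i.η⁻¹ := by rw [ht, mul_inv]; ring
  have hsmall : α₂ * ((L : ℝ) ^ i.k)⁻¹ ≤ 1 / 16 := by
    calc α₂ * ((L : ℝ) ^ i.k)⁻¹ ≤ α₂ * 1 :=
          mul_le_mul_of_nonneg_left (inv_le_one_of_one_le₀ hLk1) hα₂0.le
      _ = α₂ := mul_one _
      _ ≤ 1 / 16 := hα₂16
  have hlog : ∀ (y : Site d) (τ : Fin d), logCfg i.η W y τ = A' y τ ∧ IsSelfAdjoint (logCfg i.η W y τ) ∧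
      W y τ = cfgExp i.η (logCfg i.η W) y τ := by
    intro y τ
    have hA : ‖A' y τ‖ ≤ (α₂ * ((L : ℝ) ^ i.k)⁻¹) * i.η⁻¹ := by rw [← htη]; exact hA'bd y τ
    exact logField_spec hη (1 : Site d → Fin d → 𝔸ˣ) hWu (hWexp y τ) hA hsmall
  -- the Landau condition (1.42)₁ with multiplier `0`: the flat divergence of the constant field vanishes
  have hLan : IsLandau138W L i.k i.η (i.Ω 0) (i.Λs i.k) (1 : Site d → Fin d → 𝔸ˣ) W := by
    have hdiv : ∀ x : Site d, covDivB i.η (1 : Site d → Fin d → 𝔸ˣ) (logCfg i.η W) x = 0 := by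
      intro x
      unfold covDivB
      refine Finset.sum_eq_zero fun μ _ => ?_
      rw [covDeriv_flat_apply]
      simp only [logCfg, hWval, sub_self, smul_zero]
    refine ⟨fun _ _ => 0, fun x _ => ?_⟩
    have hind : (i.Ω 0).indicator (covDivB i.η (1 : Site d → Fin d → 𝔸ˣ) (logCfg i.η W)) = fun _ => 0 := by
      funext y
      by_cases hy : y ∈ i.Ω 0
      · rw [Set.indicator_of_mem hy]; exact hdiv y
      · exact Set.indicator_of_notMem hy _
    rw [hind, covLap_flat_apply, QT_flat_apply]
    simp
  -- the data of the clause
  have h1u : ∀ (x : Site d) (κ : Fin d), (1 : Site d → Fin d → 𝔸ˣ) x κ ∈ unitaryUnits 𝔸 := fun _ _ => (unitaryUnits 𝔸).one_mem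
  have hmul : mulCfg W (1 : Site d → Fin d → 𝔸ˣ) = W := by rw [mulCfg_eq_mul, mul_one]
  have hInA : InAk L i.k i.η s i.Ω (1 : Site d → Fin d → 𝔸ˣ) := one_inAk hL i.k hη hs0 _
  have hu1 : ∀ x, (u⁻¹) x ∈ B7Prop1Explicit.U1 𝔸 := fun x => by
    rw [Pi.inv_apply]; exact unitaryUnits_le_U1 ((unitaryUnits 𝔸).inv_mem (h1 x))
  have hPair : InAk L i.k i.η s i.Ω (mulCfg W (1 : Site d → Fin d → 𝔸ˣ)) := by
    rw [hmul, hW]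
    exact (inAk_gaugeAct_iff L i.k i.η s i.Ω hu1 _).mpr hInA
  have h162 : ∀ j, j ≤ i.k → ∀ b ∈ {b : Site d × Fin d | SideTouches (i.Ω j) b.1 b.2},
      W b.1 b.2 = cfgExp i.η (logCfg i.η W) b.1 b.2 ∧ IsSelfAdjoint (logCfg i.η W b.1 b.2) ∧
        ‖logCfg i.η W b.1 b.2‖ ≤ 1 * α₂ * ((L : ℝ) ^ j * i.η)⁻¹ := by
    intro j hj b _
    obtain ⟨hval, hsa, hexp⟩ := hlog b.1 b.2
    refine ⟨hexp, hsa, ?_⟩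
    rw [hval, one_mul]
    refine (hA'bd b.1 b.2).trans ?_
    rw [ht]
    have h0 : 0 < (L : ℝ) ^ j * i.η := by positivity
    exact mul_le_mul_of_nonneg_left (inv_anti₀ h0 (mul_le_mul_of_nonneg_right (pow_le_pow_right₀ hL1 hj) hη.le)) hα₂0.le
  have h137 : ∀ j, j ≤ i.k → ∀ cb ∈ i.Λb i.k j,
      ‖B7Prop4GeneralLevels.logCovIter L (1 : Site d → Fin d → 𝔸ˣ)
          (B8Eq146AExpansion.iEta i.η (B8LeafModelZd3.mlogCfg i.k i.η i.Ω W)) j cb.1 cb.2‖ < 2 * d * L * s := by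
    intro j hj cb hcb
    rw [hΛb j hj] at hcb
    exact absurd hcb (Set.notMem_empty _)
  -- apply the clause at the window point and the witness
  have body := H s s α₂ hs0 hsc hs0 hsc hα₂0 hα₂c h161 ⟨1, h1u⟩ (⟨1, h1u⟩, ⟨W, hWu⟩) hInA trivial hPair h162 hLan h137
  obtain ⟨⟨h136, -, -⟩, -⟩ := body
  -- read (1.36)₁ at the top level on the bond `(0, τ₀)`
  obtain ⟨-, -, hbd⟩ := h136 i.k le_rfl ((0 : Site d), τ₀) (hside i.k 0 τ₀)
  have hval : logCfg i.η W 0 τ₀ = a := by rw [(hlog 0 τ₀).1, hA'τ]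
  rw [hval, ha_norm, ht] at hbd
  have hpos : 0 < ((L : ℝ) ^ i.k * i.η)⁻¹ := by positivity
  exact hviol (le_of_mul_le_mul_right (by linarith [hbd]) hpos)

end Clause

/-! ## §2 A univ member with proper constraint sites and EMPTY bond classes (admissible in `ZdIdx`; violates the bond law №12 of `B8IdxB8LawsB`) -/

/-- **A member of `ZdIdx d L` with `Ω_j = ℤᵈ` for every `j`, `k ≥ 1` levels, spacing `η > 0`, PROPER constraint sites `Λs m j = {j = m}` (print's «Ω_j = T_η») and
EMPTY constraint-bond classes `Λb ≡ ∅`** — admissible because `ZdIdx`'s laws on `Λb` (`hbox`, `hclass`) are upper bounds; it obeys the three laws of `Node00.IdxB8Laws`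
at `η = L⁻ᵏ` (scale, truncation, cover read `Λs` only) and violates the bond law №12 (`B8IdxB8LawsB.not_idxB8LawsB_of_bonds_empty`).
[cite: Balaban1985RegularSpaces, (1.3)–(1.6) p.77, (1.12) p.78, p.77 («Ω_j = T_η»)] -/
theorem exists_member_univ_emptyBonds {L : ℕ} (hL : 1 ≤ L) {k : ℕ} (hk : 1 ≤ k) {η : ℝ} (hη : 0 < η) :
    ∃ i : ZdIdx d L, i.Ω 0 = Set.univ ∧ i.k = k ∧ i.η = η ∧ (∀ j, i.Ω j = Set.univ) ∧
      (∀ m j, i.Λs m j = {_y | j = m}) ∧ (∀ m j, i.Λb m j = ∅) := by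
  classical
  refine ⟨⟨η, hη, k, hk, fun _ => Set.univ, fun _ => le_rfl, fun m j => {_y | j = m}, fun _ _ => ∅,
      fun _ _ _ _ _ h _ _ => absurd h (Set.notMem_empty _), fun _ _ _ _ _ h => absurd h (Set.notMem_empty _),
      fun _ _ _ _ _ _ => Set.mem_univ _, ?_⟩,
    rfl, rfl, rfl, fun _ => rfl, fun _ _ => rfl, fun _ _ => rfl⟩
  intro x _
  refine ⟨k, le_rfl, flm L k x, rfl, ?_⟩
  obtain ⟨h1, h2⟩ := (under_iff_tower L k (flm L k x) x).1 (under_flm hL k x)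
  exact fun i => ⟨h1 i, h2 i⟩

/-! ## §3 ★★ Proposition 3 as typed on the law-free univ sub-family of `zdGF3` (and on all of `ZdIdx`) is FALSE -/

section Printed

variable {𝔸 : Type} [CStarAlgebra 𝔸] [Nontrivial 𝔸]

/-- ★★ **`B8.Prop3Printed` ON THE LAW-FREE UNIV SUB-FAMILY OF `zdGF3` IS FALSE** (`d ≥ 2`, `L ≥ 1`, any `β, len, C₂, inp, B₀β`, every nontrivial C⋆-algebra):
`¬ B8.Prop3Printed d L C₂ inp B₀β (fun i : {i : ZdIdx d L // i.Ω 0 = univ} ↦ (zdGF3 𝔸 L β len i.1).toGFData2)` — for every threshold `c > 0` the clause fails at the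
member of `exists_member_univ_emptyBonds` (§1).  CONSEQUENCE: every theorem taking this hypothesis (or `B8.Prop3Body c …` on that family) is VACUOUS as stated; node
N05's Proposition 3 must be read on a sub-index with the bond law (e.g. `IdxB8SubB`, or the all-torus proper members).  Nothing printed is refuted.
[cite: Balaban1985RegularSpaces, Prop. 3 p.87, (1.40)–(1.42) p.83, (1.61) p.86, (1.12) p.78, p.77] -/
theorem not_prop3Printed_zdGF3_univ (hd2 : 2 ≤ d) {L : ℕ} (hL : 1 ≤ L) (β : ℝ) (len : Site d → ℝ) (C₂ : ℝ) (inp : B8.B9Inputs)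
    (B₀β : ℝ) :
    ¬ B8.Prop3Printed d (L : ℝ) C₂ inp B₀β (fun i : {i : ZdIdx d L // i.Ω 0 = Set.univ} => (zdGF3 𝔸 L β len i.1).toGFData2) := by
  rintro ⟨c, hc, H⟩
  obtain ⟨i, hΩ0, -, -, hΩ, -, hΛb⟩ := exists_member_univ_emptyBonds (d := d) hL (k := 1) le_rfl one_pos
  exact prop3Clause_false_of_emptyBonds hd2 hL β len i hΩ (fun j _ => hΛb i.k j) hc C₂ inp B₀β (H ⟨i, hΩ0⟩)

/-- **… AND ON THE WHOLE INDEX** (the family of n05-a's `B8LeafModelZd3.prop3Printed_zd3`, whose conclusion is therefore false — its socket binder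
`∀ i, SockB9P3 … i` is unsatisfiable, as the bond-law certificates already show). [cite: Balaban1985RegularSpaces, Prop. 3 p.87, (1.12) p.78] -/
theorem not_prop3Printed_zdGF3 (hd2 : 2 ≤ d) {L : ℕ} (hL : 1 ≤ L) (β : ℝ) (len : Site d → ℝ) (C₂ : ℝ) (inp : B8.B9Inputs) (B₀β : ℝ) :
    ¬ B8.Prop3Printed d (L : ℝ) C₂ inp B₀β (fun i : ZdIdx d L => (zdGF3 𝔸 L β len i).toGFData2) := by
  rintro ⟨c, hc, H⟩
  exact not_prop3Printed_zdGF3_univ hd2 hL β len C₂ inp B₀β ⟨c, hc, fun i => H i.1⟩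

/-- **… AND ON n05-c's REPAIRED CARRIER `zdGF3H`** (which changes only the Theorem-8 source field `InR`; its `GFData2` part — everything Proposition 3 reads — IS
`zdGF3`'s, definitionally): `¬ B8.Prop3Printed d L C₂ inp B₀β (fun i : {i // i.Ω 0 = univ} ↦ (zdGF3H 𝔸 L β len i.1).toGFData2)`.
[cite: Balaban1985RegularSpaces, Prop. 3 p.87, (1.12) p.78, Thm 8 (1.146) p.101] -/
theorem not_prop3Printed_zdGF3H_univ (hd2 : 2 ≤ d) {L : ℕ} (hL : 1 ≤ L) (β : ℝ) (len : Site d → ℝ) (C₂ : ℝ) (inp : B8.B9Inputs)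
    (B₀β : ℝ) :
    ¬ B8.Prop3Printed d (L : ℝ) C₂ inp B₀β (fun i : {i : ZdIdx d L // i.Ω 0 = Set.univ} => (zdGF3H 𝔸 L β len i.1).toGFData2) :=
  not_prop3Printed_zdGF3_univ hd2 hL β len C₂ inp B₀β

end Printed

#print axioms not_prop3Printed_zdGF3_univ

end Literature.MathematicalPhysics.QuantumFieldTheory.Balaban1983to89.B8Prop3BodyNotAtEmptyBonds

end
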